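import Mathlib

/-!
# ValiantsHypothesis / RigidityForcesSymmetry — crux `LaplaceOptimalFive` (stmt-ValiantsHypothesis-24813), crux idea
`young-shadow` (K1) on the star: **T2 (BINARY) SPLITS FORCE ANTISYMMETRIC ROW RELATIONS** — letter currency
(memo `NOTE-p4g15-24813-K1-star.md` §5 LEMMA 5.2(b) «a nonzero squarefree cubic has ≥ 3 essential variables, so
`Sym³W ∩ sqfree = 0` for `dim W = 2`»; §10 withdrew it to «≥ 7» — the elementary letter proof below restores `≥ 10`)

Row relations of the letter tensor `N = P + 4E` (✓ `star_slack_sum`) are `s : Fin 5 → Fin 5 → ℂ` with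
`Σ_{a,b} s_{ab} N(a,b,c,d,e) = 0` for all `(c,d,e)`.  When one two-term split is of type T2 (✓ `two_term_split`, binary exit of
✓ `lemmaK`: the columns of `U₁, U₂` lie in `span{e,f}` and `W₁, W₂` are annihilated by every `v ⊥ e,f`), the slack `E` is annihilated
by every `v ⊥ e, f` in each slot.  Then:

* `sqfree_symm3_eq_zero` — a symmetric `F : Fin 5³ → ℂ` vanishing on repeated letters and annihilated in one slot by all
  `v ∈ {e,f}^⊥` is `0`.  (For distinct `a,b,c` pick `0 ≠ t ∈ ℂ³` with `t₀e_a+t₁e_b+t₂e_c = t₀f_a+t₁f_b+t₂f_c = 0` — it exists since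
  `2 < 3` (`LinearMap.ker_ne_bot_of_finrank_lt`); annihilation at `(b,c)`, `(a,c)`, `(a,b)` reads `t₀F_{abc} = t₁F_{abc} = t₂F_{abc} = 0`.)
* `relations_kill_pattern_of_binary` — hence every relation `s` of `P + κE` (`P` symmetric and vanishing on repeated letters in
  its last three slots, `E` `{e,f}^⊥`-annihilated in its third slot) satisfies `Σ_{a,b} s_{ab}P(a,b,c,d,e) = 0`.
* `pairSum_pattern_eval` — for pairwise distinct letters `a,b,c,d,e` covering `Fin 5` and `P` vanishing whenever one of its
  first two letters repeats one of the last three or each other: `Σ_{x,y} s_{xy}P(x,y,c,d,e) = s_{ab}P(a,b,c,d,e) + s_{ba}P(b,a,c,d,e)`.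
  With `P = [letters distinct]` this is `s_{ab} + s_{ba}`: the relations are ANTISYMMETRIC off the diagonal, and
  ✓ `ten_le_of_offDiag_relations` gives `|T| ≥ 10`, i.e. weight `≥ 120`, in the T2 case.

Mathlib only; no definitions, no `sorry`.  Honest framing: (L1) brick for the T2 branch, closes nothing; K1-on-the-star PAPER PASS,
not kernel; `LaplaceOptimalFive` OPEN · CONTESTED 72/120; `VP ≠ VNP` NOT proved.
-/

set_option linter.dupNamespace false

namespace Summit.ValiantsHypothesis.ValiantsHypothesis.Theorems.RigidityForcesSymmetryRankRigidMinimalRepr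

namespace LaplaceFiveStar

open Finset Module

/-- **A squarefree-supported symmetric 3-tensor annihilated in one slot by `{e,f}^⊥` vanishes.** [folklore] -/
theorem sqfree_symm3_eq_zero (F : Fin 5 → Fin 5 → Fin 5 → ℂ)
    (h12 : ∀ a b c : Fin 5, F a b c = F b a c) (h23 : ∀ a b c : Fin 5, F a b c = F a c b)
    (hsq : ∀ a c : Fin 5, F a a c = 0) (e f : Fin 5 → ℂ)
    (hann : ∀ v : Fin 5 → ℂ, ∑ x : Fin 5, v x * e x = 0 → ∑ x : Fin 5, v x * f x = 0 →
      ∀ b c : Fin 5, ∑ a : Fin 5, v a * F a b c = 0)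
    (a b c : Fin 5) : F a b c = 0 := by
  classical
  by_cases hab : a = b
  · subst hab; exact hsq a c
  by_cases hac : a = c
  · subst hac; rw [h23]; exact hsq a b
  by_cases hbc : b = c
  · subst hbc; rw [h12, h23]; exact hsq b a
  -- a non-zero vector of `{e,f}^⊥` supported on `{a,b,c}` (`2 < 3`)
  let ψ : (Fin 3 → ℂ) →ₗ[ℂ] (ℂ × ℂ) :=
    { toFun := fun t => (t 0 * e a + t 1 * e b + t 2 * e c, t 0 * f a + t 1 * f b + t 2 * f c)
      map_add' := fun s t => by
        simp only [Pi.add_apply, Prod.mk_add_mk]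
        refine Prod.ext ?_ ?_ <;> simp only <;> ring
      map_smul' := fun r t => by
        simp only [Pi.smul_apply, smul_eq_mul, RingHom.id_apply, Prod.smul_mk]
        refine Prod.ext ?_ ?_ <;> simp only <;> ring }
  have hlt : finrank ℂ (ℂ × ℂ) < finrank ℂ (Fin 3 → ℂ) := by
    rw [Module.finrank_prod, Module.finrank_self, Module.finrank_fin_fun]
    norm_num
  obtain ⟨t, ht, ht0⟩ := Submodule.exists_mem_ne_zero_of_ne_bot (LinearMap.ker_ne_bot_of_finrank_lt hlt (f := ψ))
  rw [LinearMap.mem_ker] at ht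
  have hte : t 0 * e a + t 1 * e b + t 2 * e c = 0 := congr_arg Prod.fst ht
  have htf : t 0 * f a + t 1 * f b + t 2 * f c = 0 := congr_arg Prod.snd ht
  let v : Fin 5 → ℂ := fun x =>
    t 0 * (if x = a then 1 else 0) + t 1 * (if x = b then 1 else 0) + t 2 * (if x = c then 1 else 0)
  have hv : ∀ g : Fin 5 → ℂ, ∑ x : Fin 5, v x * g x = t 0 * g a + t 1 * g b + t 2 * g c := by
    intro g
    simp only [v, add_mul, mul_assoc, Finset.sum_add_distrib, ← Finset.mul_sum, ite_mul, one_mul, zero_mul,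
      Finset.sum_ite_eq', Finset.mem_univ, if_true]
  have hve : ∑ x : Fin 5, v x * e x = 0 := by rw [hv, hte]
  have hvf : ∑ x : Fin 5, v x * f x = 0 := by rw [hv, htf]
  have k1 : t 0 * F a b c = 0 := by
    have h := hann v hve hvf b c
    rw [hv (fun x => F x b c)] at h
    have e2 : F b b c = 0 := hsq b c
    have e3 : F c b c = 0 := by rw [h23]; exact hsq c b
    simpa only [e2, e3, mul_zero, add_zero] using h
  have k2 : t 1 * F a b c = 0 := by
    have h := hann v hve hvf a c
    rw [hv (fun x => F x a c)] at h
    have e1 : F a a c = 0 := hsq a c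
    have e3 : F c a c = 0 := by rw [h23]; exact hsq c a
    have e2 : F b a c = F a b c := (h12 a b c).symm
    simpa only [e1, e3, e2, mul_zero, zero_add, add_zero] using h
  have k3 : t 2 * F a b c = 0 := by
    have h := hann v hve hvf a b
    rw [hv (fun x => F x a b)] at h
    have e1 : F a a b = 0 := hsq a b
    have e2 : F b a b = 0 := by rw [h23]; exact hsq b a
    have e3 : F c a b = F a b c := by rw [h12, h23]
    simpa only [e1, e2, e3, mul_zero, zero_add] using h
  by_contra hF
  apply ht0
  funext i
  fin_cases i
  · exact (mul_eq_zero.mp k1).resolve_right hF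
  · exact (mul_eq_zero.mp k2).resolve_right hF
  · exact (mul_eq_zero.mp k3).resolve_right hF

/-- **T2 ⟹ the relations kill the pattern part.**  If `E` is annihilated in its third slot by `{e,f}^⊥` and `P`, `E` are symmetric
(`P`) in the last three slots with `P` vanishing on a repeated letter there, then every relation `s` of `P + κE` satisfies
`Σ_{a,b} s_{ab} P(a,b,c,d,x) = 0`. [folklore] -/
theorem relations_kill_pattern_of_binary (P E : Fin 5 → Fin 5 → Fin 5 → Fin 5 → Fin 5 → ℂ)
    (hP34 : ∀ a b c d x : Fin 5, P a b c d x = P a b d c x) (hP45 : ∀ a b c d x : Fin 5, P a b c d x = P a b c x d)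
    (hPrep : ∀ a b c x : Fin 5, P a b c c x = 0)
    (e f : Fin 5 → ℂ)
    (hEann : ∀ v : Fin 5 → ℂ, ∑ y : Fin 5, v y * e y = 0 → ∑ y : Fin 5, v y * f y = 0 →
      ∀ a b d x : Fin 5, ∑ c : Fin 5, v c * E a b c d x = 0)
    (κ : ℂ) (s : Fin 5 → Fin 5 → ℂ)
    (hrel : ∀ c d x : Fin 5, ∑ a : Fin 5, ∑ b : Fin 5, s a b * (P a b c d x + κ * E a b c d x) = 0)
    (c d x : Fin 5) : ∑ a : Fin 5, ∑ b : Fin 5, s a b * P a b c d x = 0 := by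
  let F : Fin 5 → Fin 5 → Fin 5 → ℂ := fun c d x => ∑ a : Fin 5, ∑ b : Fin 5, s a b * P a b c d x
  have hF : ∀ c d x : Fin 5, F c d x = -κ * ∑ a : Fin 5, ∑ b : Fin 5, s a b * E a b c d x := by
    intro c d x
    have h := hrel c d x
    simp only [mul_add, Finset.sum_add_distrib] at h
    have h2 : ∑ a : Fin 5, ∑ b : Fin 5, s a b * (κ * E a b c d x) = κ * ∑ a : Fin 5, ∑ b : Fin 5, s a b * E a b c d x := by
      rw [Finset.mul_sum]
      refine Finset.sum_congr rfl fun a _ => ?_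
      rw [Finset.mul_sum]
      exact Finset.sum_congr rfl fun b _ => by ring
    rw [h2] at h
    show ∑ a : Fin 5, ∑ b : Fin 5, s a b * P a b c d x = _
    linear_combination h
  refine sqfree_symm3_eq_zero F (fun c d x => ?_) (fun c d x => ?_) (fun c x => ?_) e f (fun v hve hvf d x => ?_) c d x
  · exact Finset.sum_congr rfl fun a _ => Finset.sum_congr rfl fun b _ => by rw [hP34]
  · exact Finset.sum_congr rfl fun a _ => Finset.sum_congr rfl fun b _ => by rw [hP45]
  · exact Finset.sum_eq_zero fun a _ => Finset.sum_eq_zero fun b _ => by rw [hPrep, mul_zero]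
  · have h1 : ∀ c' : Fin 5, v c' * F c' d x = -κ * ∑ a : Fin 5, ∑ b : Fin 5, s a b * (v c' * E a b c' d x) := by
      intro c'
      rw [hF, Finset.mul_sum, Finset.mul_sum, Finset.mul_sum]
      refine Finset.sum_congr rfl fun a _ => ?_
      rw [Finset.mul_sum, Finset.mul_sum, Finset.mul_sum]
      exact Finset.sum_congr rfl fun b _ => by ring
    rw [Finset.sum_congr rfl fun c' _ => h1 c', ← Finset.mul_sum, Finset.sum_comm]
    have h2 : ∑ a : Fin 5, ∑ c' : Fin 5, ∑ b : Fin 5, s a b * (v c' * E a b c' d x) = 0 := by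
      refine Finset.sum_eq_zero fun a _ => ?_
      rw [Finset.sum_comm]
      refine Finset.sum_eq_zero fun b _ => ?_
      rw [← Finset.mul_sum, hEann v hve hvf a b d x, mul_zero]
    rw [h2, mul_zero]

/-- **Evaluation of a pair sum against a pattern-like tensor.**  For pairwise distinct letters `a,b,c,d,e` covering `Fin 5` and
`P` vanishing when one of its first two letters equals one of the last three or the other: `Σ_{x,y} s_{xy}P(x,y,c,d,e) =
s_{ab}P(a,b,c,d,e) + s_{ba}P(b,a,c,d,e)`. [folklore] -/
theorem pairSum_pattern_eval (P : Fin 5 → Fin 5 → Fin 5 → Fin 5 → Fin 5 → ℂ) (s : Fin 5 → Fin 5 → ℂ)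
    (a b c d e : Fin 5) (hab : a ≠ b) (hcover : ∀ i : Fin 5, i = a ∨ i = b ∨ i = c ∨ i = d ∨ i = e)
    (hP0 : ∀ x y : Fin 5, (x = y ∨ x = c ∨ x = d ∨ x = e ∨ y = c ∨ y = d ∨ y = e) → P x y c d e = 0) :
    ∑ x : Fin 5, ∑ y : Fin 5, s x y * P x y c d e = s a b * P a b c d e + s b a * P b a c d e := by
  classical
  have hinner : ∀ x y : Fin 5, x ≠ y → (x = a ∨ x = b) → (y = a ∨ y = b) →
      ∑ y' : Fin 5, s x y' * P x y' c d e = s x y * P x y c d e := by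
    intro x y hxy hx hy
    refine Finset.sum_eq_single_of_mem y (Finset.mem_univ y) fun y' _ hy' => ?_
    rw [hP0 x y' ?_, mul_zero]
    rcases hcover y' with h | h | h | h | h
    · rcases hx with hx | hx
      · exact Or.inl (hx.trans h.symm)
      · rcases hy with hy | hy
        · exact absurd (h.trans hy.symm) hy'
        · exact absurd (hx.trans hy.symm) hxy
    · rcases hx with hx | hx
      · rcases hy with hy | hy
        · exact absurd (hx.trans hy.symm) hxy
        · exact absurd (h.trans hy.symm) hy'
      · exact Or.inl (hx.trans h.symm)
    · exact Or.inr (Or.inr (Or.inr (Or.inr (Or.inl h))))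
    · exact Or.inr (Or.inr (Or.inr (Or.inr (Or.inr (Or.inl h)))))
    · exact Or.inr (Or.inr (Or.inr (Or.inr (Or.inr (Or.inr h)))))
  rw [Finset.sum_eq_add_of_mem a b (Finset.mem_univ a) (Finset.mem_univ b) hab]
  · rw [hinner a b hab (Or.inl rfl) (Or.inr rfl), hinner b a (Ne.symm hab) (Or.inr rfl) (Or.inl rfl)]
  · intro x _ hx
    refine Finset.sum_eq_zero fun y _ => ?_
    rw [hP0 x y ?_, mul_zero]
    rcases hcover x with h | h | h | h | h
    · exact absurd h hx.1
    · exact absurd h hx.2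
    · exact Or.inr (Or.inl h)
    · exact Or.inr (Or.inr (Or.inl h))
    · exact Or.inr (Or.inr (Or.inr (Or.inl h)))
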